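import Summits.AtomisticToContinuum.HydrodynamicLimit.Theorems.ImplosionDichotomyPolynomialCompressionSolutionAPI

/-!
# Classical existence on a prescribed horizon from local existence, uniqueness, continuation and
# a-priori bounds (the soft half of `stub_conditionalExistence`)

Helper file for the line `log-lipschitz-budget` of the crux
`ImplosionDichotomy.PolynomialCompression` (stub `stub_conditionalExistence`). That stub packages
the Kato/Majda theory of the hard-sphere Euler system as "a-priori bounds for every classical
solution with the given data on every `[0, T)`, `T ≤ T'` ⟹ a classical solution with these data
exists on `[0, T')`". Its ANALYTIC
inputs — (a) local existence for smooth data, (b) continuation of a classical solution obeying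
the a-priori bounds beyond its horizon, (c) uniqueness of classical solutions with equal data —
are Kato 1975 (ARMA 58) Thms I–III / Majda 1984 Thms 2.1–2.2 and are not in the tree. This file
proves the remaining SOFT half once and for all, for an arbitrary a-priori predicate `P`:

* `isHardSphereEulerSolution_exists_of_apriori` — (a) + (b) + (c) + "every solution with the data
  on `[0, T)`, `T ≤ T'`, satisfies `P T`" ⟹ a classical solution with the data exists on `[0, T')`.

Proof: the set `S` of horizons `T ≤ T'` carrying a solution with the data is nonempty by (a) and
bounded by `T'`; by (c) the solutions on the horizons below `T⋆ = sup S` are restrictions of one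
another, so they GLUE (`isHardSphereEulerSolution_of_forall_lt`, `isHardSphereEulerSolution_congr`
of the solution API) to a solution on `[0, T⋆)`; if `T⋆ < T'` the a-priori bounds and (b) push the
horizon beyond `T⋆`, contradicting `T⋆ = sup S`. Hence `T⋆ = T'`.
-/

namespace Summit.AtomisticToContinuum.HydrodynamicLimit.Theorems

open Set
open Literature.MathematicalPhysics.KineticTheory Literature.Analysis.FunctionSpaces

/-- **Existence on a prescribed horizon from a-priori bounds (soft continuation argument).**
Fix `σ`, data `(ρ₀, u₀, θ₀)`, a horizon `T' > 0` and an a-priori predicate `P T ρ u θ` on classical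
hard-sphere–Euler solutions on `[0, T)`. Assume (a) some classical solution with the data exists on
some `[0, T)`, `T > 0`; (c) two classical solutions on a common `[0, T)` with equal data agree
slice-wise on `[0, T)`; (b) every classical solution with the data on `[0, T)`, `0 < T < T'`,
satisfying `P T` extends to a classical solution on a strictly longer interval agreeing with it on
`[0, T)`; and the a-priori bound: every classical solution with the data on `[0, T)`, `T ≤ T'`,
satisfies `P T`. Then a classical solution with the data exists on `[0, T')`. [folklore] -/
theorem isHardSphereEulerSolution_exists_of_apriori :
    ∀ {σ T' : ℝ} {ρ₀ θ₀ : T3 → ℝ} {u₀ : T3 → V3}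
      (P : ℝ → (ℝ → T3 → ℝ) → (ℝ → T3 → V3) → (ℝ → T3 → ℝ) → Prop), 0 < T' →
      (∃ T : ℝ, 0 < T ∧ ∃ (ρ θ : ℝ → T3 → ℝ) (u : ℝ → T3 → V3),
        IsHardSphereEulerSolution σ T ρ u θ ∧ ρ 0 = ρ₀ ∧ u 0 = u₀ ∧ θ 0 = θ₀) →
      (∀ (T : ℝ) (ρ₁ θ₁ : ℝ → T3 → ℝ) (u₁ : ℝ → T3 → V3) (ρ₂ θ₂ : ℝ → T3 → ℝ) (u₂ : ℝ → T3 → V3),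
        IsHardSphereEulerSolution σ T ρ₁ u₁ θ₁ → IsHardSphereEulerSolution σ T ρ₂ u₂ θ₂ →
        ρ₁ 0 = ρ₂ 0 → u₁ 0 = u₂ 0 → θ₁ 0 = θ₂ 0 →
        ∀ t ∈ Ico 0 T, ρ₁ t = ρ₂ t ∧ u₁ t = u₂ t ∧ θ₁ t = θ₂ t) →
      (∀ T : ℝ, 0 < T → T < T' → ∀ (ρ θ : ℝ → T3 → ℝ) (u : ℝ → T3 → V3),
        IsHardSphereEulerSolution σ T ρ u θ → ρ 0 = ρ₀ → u 0 = u₀ → θ 0 = θ₀ → P T ρ u θ →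
        ∃ T₂ : ℝ, T < T₂ ∧ ∃ (ρ' θ' : ℝ → T3 → ℝ) (u' : ℝ → T3 → V3),
          IsHardSphereEulerSolution σ T₂ ρ' u' θ' ∧
          ∀ t ∈ Ico 0 T, ρ' t = ρ t ∧ u' t = u t ∧ θ' t = θ t) →
      (∀ T : ℝ, T ≤ T' → ∀ (ρ θ : ℝ → T3 → ℝ) (u : ℝ → T3 → V3),
        IsHardSphereEulerSolution σ T ρ u θ → ρ 0 = ρ₀ → u 0 = u₀ → θ 0 = θ₀ → P T ρ u θ) →
      ∃ (ρ θ : ℝ → T3 → ℝ) (u : ℝ → T3 → V3),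
        IsHardSphereEulerSolution σ T' ρ u θ ∧ ρ 0 = ρ₀ ∧ u 0 = u₀ ∧ θ 0 = θ₀ := by
  intro σ T' ρ₀ θ₀ u₀ P hT' hloc huniq hcont hbd
  classical
  -- the set of horizons `T ≤ T'` carrying a classical solution with the data
  set S : Set ℝ := {T | T ≤ T' ∧ ∃ (ρ θ : ℝ → T3 → ℝ) (u : ℝ → T3 → V3),
    IsHardSphereEulerSolution σ T ρ u θ ∧ ρ 0 = ρ₀ ∧ u 0 = u₀ ∧ θ 0 = θ₀} with hS
  have hbdd : BddAbove S := ⟨T', fun T hT => hT.1⟩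
  obtain ⟨T₀, hT₀, ρa, θa, ua, ha, hρa, hua, hθa⟩ := hloc
  have hT₀S : min T₀ T' ∈ S :=
    ⟨min_le_right _ _, ρa, θa, ua, isHardSphereEulerSolution_restrict ha (min_le_left _ _),
      hρa, hua, hθa⟩
  have hne : S.Nonempty := ⟨_, hT₀S⟩
  set Ts : ℝ := sSup S with hTs
  have hTs_le : Ts ≤ T' := csSup_le hne fun T hT => hT.1
  have hTs_pos : 0 < Ts := lt_of_lt_of_le (lt_min hT₀ hT') (le_csSup hbdd hT₀S)
  -- a solution with the data on every horizon of `S` (choice)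
  have hS2 : ∀ T ∈ S, ∃ (ρ θ : ℝ → T3 → ℝ) (u : ℝ → T3 → V3),
      IsHardSphereEulerSolution σ T ρ u θ ∧ ρ 0 = ρ₀ ∧ u 0 = u₀ ∧ θ 0 = θ₀ := fun T hT => hT.2
  choose ρf θf uf hsol hρ0 hu0 hθ0 using hS2
  -- every `t < Ts` lies below some horizon of `S` (choice)
  have hex : ∀ t : ℝ, t < Ts → ∃ T ∈ S, t < T := fun t ht => exists_lt_of_lt_csSup hne ht
  choose Tof hTofS htTof using hex
  -- the glued fields on `[0, Ts)`
  set ρs : ℝ → T3 → ℝ := fun t => if h : t < Ts then ρf (Tof t h) (hTofS t h) t else ρ₀ with hρs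
  set us : ℝ → T3 → V3 := fun t => if h : t < Ts then uf (Tof t h) (hTofS t h) t else u₀ with hus
  set θs : ℝ → T3 → ℝ := fun t => if h : t < Ts then θf (Tof t h) (hTofS t h) t else θ₀ with hθs
  -- by uniqueness the glued fields agree with every chosen solution on its horizon
  have hagree : ∀ (T : ℝ) (hT : T ∈ S), ∀ t ∈ Ico 0 T, t < Ts →
      ρs t = ρf T hT t ∧ us t = uf T hT t ∧ θs t = θf T hT t := by
    intro T hT t ht htTs
    have h₁ : ρs t = ρf (Tof t htTs) (hTofS t htTs) t := by simp only [hρs, dif_pos htTs]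
    have h₂ : us t = uf (Tof t htTs) (hTofS t htTs) t := by simp only [hus, dif_pos htTs]
    have h₃ : θs t = θf (Tof t htTs) (hTofS t htTs) t := by simp only [hθs, dif_pos htTs]
    have hmin : t ∈ Ico 0 (min (Tof t htTs) T) := ⟨ht.1, lt_min (htTof t htTs) ht.2⟩
    have hu := huniq (min (Tof t htTs) T) (ρf _ (hTofS t htTs)) (θf _ (hTofS t htTs))
      (uf _ (hTofS t htTs)) (ρf T hT) (θf T hT) (uf T hT)
      (isHardSphereEulerSolution_restrict (hsol _ (hTofS t htTs)) (min_le_left _ _))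
      (isHardSphereEulerSolution_restrict (hsol T hT) (min_le_right _ _))
      (by rw [hρ0, hρ0]) (by rw [hu0, hu0]) (by rw [hθ0, hθ0]) t hmin
    exact ⟨h₁.trans hu.1, h₂.trans hu.2.1, h₃.trans hu.2.2⟩
  -- hence they are a classical solution on `[0, Ts)` (gluing) …
  have hsolTs : IsHardSphereEulerSolution σ Ts ρs us θs := by
    refine isHardSphereEulerSolution_of_forall_lt fun T hT => ?_
    obtain ⟨T₃, hT₃S, hTT₃⟩ := exists_lt_of_lt_csSup hne hT
    refine isHardSphereEulerSolution_congr
      (isHardSphereEulerSolution_restrict (hsol T₃ hT₃S) hTT₃.le)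
      (fun t ht => ?_) (fun t ht => ?_) (fun t ht => ?_)
    · exact (hagree T₃ hT₃S t ⟨ht.1, ht.2.trans hTT₃⟩ (ht.2.trans hT)).1
    · exact (hagree T₃ hT₃S t ⟨ht.1, ht.2.trans hTT₃⟩ (ht.2.trans hT)).2.1
    · exact (hagree T₃ hT₃S t ⟨ht.1, ht.2.trans hTT₃⟩ (ht.2.trans hT)).2.2
  -- … with the prescribed data
  have hρs0 : ρs 0 = ρ₀ := by
    have h : ρs 0 = ρf (Tof 0 hTs_pos) (hTofS 0 hTs_pos) 0 := by simp only [hρs, dif_pos hTs_pos]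
    rw [h, hρ0]
  have hus0 : us 0 = u₀ := by
    have h : us 0 = uf (Tof 0 hTs_pos) (hTofS 0 hTs_pos) 0 := by simp only [hus, dif_pos hTs_pos]
    rw [h, hu0]
  have hθs0 : θs 0 = θ₀ := by
    have h : θs 0 = θf (Tof 0 hTs_pos) (hTofS 0 hTs_pos) 0 := by simp only [hθs, dif_pos hTs_pos]
    rw [h, hθ0]
  -- if `Ts < T'`, the a-priori bounds and continuation push the horizon beyond `sup S`: absurd
  have hTs_eq : Ts = T' := by
    by_contra hne'
    have hlt : Ts < T' := lt_of_le_of_ne hTs_le hne'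
    have hP := hbd Ts hTs_le ρs θs us hsolTs hρs0 hus0 hθs0
    obtain ⟨T₂, hTsT₂, ρ', θ', u', hsol', hagr'⟩ :=
      hcont Ts hTs_pos hlt ρs θs us hsolTs hρs0 hus0 hθs0 hP
    have h0 : (0 : ℝ) ∈ Ico 0 Ts := ⟨le_rfl, hTs_pos⟩
    have hmem : min T₂ T' ∈ S :=
      ⟨min_le_right _ _, ρ', θ', u', isHardSphereEulerSolution_restrict hsol' (min_le_left _ _),
        by rw [(hagr' 0 h0).1, hρs0], by rw [(hagr' 0 h0).2.1, hus0],
        by rw [(hagr' 0 h0).2.2, hθs0]⟩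
    exact absurd (le_csSup hbdd hmem) (not_le.2 (lt_min hTsT₂ hlt))
  exact ⟨ρs, θs, us, hTs_eq ▸ hsolTs, hρs0, hus0, hθs0⟩

end Summit.AtomisticToContinuum.HydrodynamicLimit.Theorems
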